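import Summits.KontsevichZagierPeriods.KontsevichZagierPeriods.Theorems.SoloBlindHomogeneous
import HarnessLib

/-!
# Graded multiplicativity of the homogeneous sectors: `H_i(μ) · H_j(μ) ⊆ H_{i+j}(μ)`

Solo programme `solo-KontsevichZagierPeriods-blind`, session 5.

The `K₀`-linear sectors of `SoloBlindHomogeneous` are preimages under `mkQ` of `K₀`-spans in the
commutative `K₀`-algebra `Q`; products of sectors are controlled by products of spans
(`modSector_mul_le`).  For the homogeneous sectors the monomial generators multiply into monomial
generators (`homGen_mul_homGen`), so `H_i(μ) · H_j(μ) ⊆ H_{i+j}(μ)` (`mul_mem_homSector`) and the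
Fubini PRODUCT of two integral representations lying in `H_i(μ)`, `H_j(μ)` lies in `H_{i+j}(μ)`
(`prod_mem_homSector`).  Consequently the decided regions `H_k(μ)` of the Kontsevich–Zagier
conjecture are closed under the product rule of the calculus, degree by degree: e.g. KZ holds for
`Z × Z`, `Z × (L(1;μ) × L(1;μ))`, `S × (A(1;1) × L(1;μ))`, … against all of `H₄(μ)`
(`kz_prod_homSector`).

Honest scope: this is bookkeeping over Gelfond–Schneider (`kz_homSector`); the sum
`⊕_k H_k(μ) = K₀[x_π, ℓ(μ)]` is NOT shown eval-injective (that would be the algebraic independence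
of `π` and `log μ`, open).
-/

noncomputable section

namespace Summit.KontsevichZagierPeriods.KontsevichZagierPeriods.Theorems

open Set MeasureTheory
open Literature.NumberTheory.Transcendental
open Literature.NumberTheory.Transcendental.KZ

namespace SoloBlind

variable {ι κ ν : Type}

/-- **Products of sectors.** If every product of generators `gᵢ · hⱼ` lies in the span of the
family `f`, then `modSector g · modSector h ⊆ modSector f`. -/
theorem modSector_mul_le {g : ι → Q} {h : κ → Q} {f : ν → Q}
    (hgh : ∀ i j, g i * h j ∈ Submodule.span K₀ (Set.range f)) {y z : FormalRep}
    (hy : y ∈ modSector g) (hz : z ∈ modSector h) : y * z ∈ modSector f := by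
  rw [mem_modSector] at hy hz ⊢
  rw [mkQ_mul]
  have hle : Submodule.span K₀ (Set.range g) * Submodule.span K₀ (Set.range h) ≤
      Submodule.span K₀ (Set.range f) := by
    rw [Submodule.span_mul_span, Submodule.span_le]
    rintro _ ⟨_, ⟨i, rfl⟩, _, ⟨j, rfl⟩, rfl⟩
    exact hgh i j
  exact hle (Submodule.mul_mem_mul hy hz)

/-- Monomials multiply: `(x_π^a ℓ^{i-a}) (x_π^b ℓ^{j-b}) = x_π^{a+b} ℓ^{i+j-(a+b)}`. -/
theorem homGen_mul_homGen (μ : ℝ) (i j : ℕ) (a : Fin (i + 1)) (b : Fin (j + 1)) :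
    homGen μ i a * homGen μ j b =
      homGen μ (i + j) ⟨(a : ℕ) + (b : ℕ), by omega⟩ := by
  have ha : (a : ℕ) ≤ i := Nat.lt_succ_iff.mp a.2
  have hb : (b : ℕ) ≤ j := Nat.lt_succ_iff.mp b.2
  simp only [homGen]
  rw [show i + j - ((a : ℕ) + (b : ℕ)) = (i - (a : ℕ)) + (j - (b : ℕ)) by omega, pow_add, pow_add]
  ring

/-- **`H_i(μ) · H_j(μ) ⊆ H_{i+j}(μ)`.** -/
theorem mul_mem_homSector (μ : ℝ) {i j : ℕ} {y z : FormalRep} (hy : y ∈ homSector μ i)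
    (hz : z ∈ homSector μ j) : y * z ∈ homSector μ (i + j) :=
  modSector_mul_le (fun a b => by
    rw [homGen_mul_homGen]
    exact Submodule.subset_span (mem_range_self _)) hy hz

/-- **Fubini products stay in the graded sectors**: `r ∈ H_i(μ)`, `r' ∈ H_j(μ)` ⇒
`r × r' ∈ H_{i+j}(μ)`. -/
theorem prod_mem_homSector (μ : ℝ) {i j n m : ℕ} {r : IntegralRep n} {r' : IntegralRep m}
    (hr : of r ∈ homSector μ i) (hr' : of r' ∈ homSector μ j) :
    of (r.prod r') ∈ homSector μ (i + j) := by
  rw [← of_mul_of]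
  exact mul_mem_homSector μ hr hr'

/-- **KZ for products, degree by degree.** If `r₁ ∈ H_i(μ)`, `r₂ ∈ H_j(μ)` and `r'` is any
representation in `H_{i+j}(μ)` with the same period as `r₁ × r₂`, then `r₁ × r₂ ∼ r'`
(`μ > 1` real algebraic; Gelfond–Schneider via `kz_homSector`). -/
theorem kz_prod_homSector {μ : ℝ} (hμ : IsAlgebraic ℚ μ) (h1 : 1 < μ) {i j n₁ n₂ m : ℕ}
    {r₁ : IntegralRep n₁} {r₂ : IntegralRep n₂} (hr₁ : of r₁ ∈ homSector μ i)
    (hr₂ : of r₂ ∈ homSector μ j) (r' : IntegralRep m) (hr' : of r' ∈ homSector μ (i + j))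
    (hv : r₁.value * r₂.value = r'.value) : Equivalent (r₁.prod r₂) r' :=
  kz_homSector hμ h1 _ r' (prod_mem_homSector μ hr₁ hr₂) hr'
    (by rw [IntegralRep.value_prod, hv])

/-! ## Instances in degree `4` -/

/-- `Z × Z ∈ H₄(μ)` (period `ζ(2)² = π⁴/36`). -/
theorem of_zetaTwoRep_prod_self_mem_homSector (μ : ℝ) :
    of (zetaTwoRep.prod zetaTwoRep) ∈ homSector μ 4 :=
  prod_mem_homSector (i := 2) (j := 2) μ (of_zetaTwoRep_mem_homSector μ)
    (of_zetaTwoRep_mem_homSector μ)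

/-- `S × (L(1;μ) × L(1;μ)) ∈ H₄(μ)` (period `ζ(2) log² μ`). -/
theorem of_unitSquare_prod_logSq_mem_homSector {μ : ℝ} (hμ : IsAlgebraic ℚ μ) :
    of (unitSquareRep.prod
      ((logCell 1 μ isAlgebraic_one hμ).prod (logCell 1 μ isAlgebraic_one hμ))) ∈
      homSector μ 4 :=
  prod_mem_homSector (i := 2) (j := 2) μ (of_unitSquareRep_mem_homSector μ)
    (of_logCell_prod_mem_homSector hμ)

/-- `Z × (A(1;1) × L(1;μ)) ∈ H₄(μ)` (period `ζ(2) · (π/4) · log μ`). -/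
theorem of_zetaTwo_prod_atanLog_mem_homSector {μ : ℝ} (hμ : IsAlgebraic ℚ μ) :
    of (zetaTwoRep.prod
      ((atanCell 1 1 isAlgebraic_one isAlgebraic_one).prod (logCell 1 μ isAlgebraic_one hμ))) ∈
      homSector μ 4 :=
  prod_mem_homSector (i := 2) (j := 2) μ (of_zetaTwoRep_mem_homSector μ)
    (of_atanCell_prod_logCell_mem_homSector hμ)

/-- **A degree-4 decided pair**: `S × (L(1;μ) × L(1;μ))` is KZ-equivalent to every
representation in `H₄(μ)` with period `ζ(2) · log² μ` — e.g. to `Z × (L(1;μ²)/2 × L(1;μ))`-type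
rewritings — for every real algebraic `μ > 1`. -/
theorem kz_unitSquare_prod_logSq {μ : ℝ} (hμ : IsAlgebraic ℚ μ) (h1 : 1 < μ) {m : ℕ}
    (r' : IntegralRep m) (hr' : of r' ∈ homSector μ 4)
    (hv : r'.value = Real.pi ^ 2 / 6 * Real.log μ ^ 2) :
    Equivalent (unitSquareRep.prod
      ((logCell 1 μ isAlgebraic_one hμ).prod (logCell 1 μ isAlgebraic_one hμ))) r' :=
  kz_homSector hμ h1 _ r' (of_unitSquare_prod_logSq_mem_homSector hμ) hr' (by
    rw [IntegralRep.value_prod, IntegralRep.value_prod, unitSquareRep_value,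
      value_logCell h1.le, one_mul, hv, sq (Real.log μ)])

end SoloBlind

end Summit.KontsevichZagierPeriods.KontsevichZagierPeriods.Theorems

end
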